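import Summits.ValiantsHypothesis.ValiantsHypothesis.Theorems.LacunarySymmetroidMatrixDescartesDoorA26WallBubblingTwoScaleTripleTop

/-!
# Wall bubbling for `DoorA26` — (W-split) rung 3b: THE TRIPLE CLASS ACROSS TWO SCALES, MIDDLE RULE («t-slot alive upstream ⇒ no t²-slot downstream»)

HONEST FRAMING.  Chain lemma for obligation (W) `stub_weylFaces` of `Cruxes/DoorA26/Lines/wall_bubbling.lean` (stmt-ValiantsHypothesis-19979
`DoorA26`; OPEN, typed, never asserted), W2 seat val-sym-door-p1 g14; named residual «(W-split) multi-scale linking» (register R2761).  Companion of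
`…TwoScaleTripleTop` (instance (i) of the triple's slot splitting); this file is instance (ii):

* `triple_mid_core` — scalar bookkeeping WITHOUT any hypothesis on `g₅₅` upstream: `κμ ≤ |g₀₅|`, `|g₀₀| ≤ μ`; downstream `(0,0)` and `(0,5)`
  dominated by `μ'`, the `t²`-slot alive (`κ'μ' ≤ E₀²e²|g₅₅|`); `|Λ| ≥ 4/κ` ⇒ `|Λ| ≤ (1 + 12/κ')·e` (four regimes of `|Λ||g₅₅|` against `|g₀₅|`:
  `≥ 3|g₀₅|`, `≤ |g₀₅|/2`, and in between according to `|2g₀₅ + Λg₅₅| ≷ |g₀₅|/2` — the frame-level shadow of «the roots of the quadratic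
  `Q(X) = G₀₀ + 2G₀₅X + G₅₅X²` sit at bounded X-ratio from at most two clusters»);
* **`twoScale_triple_mid`** — under the hypotheses of `twoScale_monotone`: `Γ 0 5 ≠ 0 → Γ' 5 5 = 0`.

With #19 (doubletons) and `…TwoScaleTripleTop` this completes the TWO-scale part of `hsplit` (doubletons: at most one cluster carries the t-slot;
triple: degrees `(2,0)`, `(1,≤1)` downstream, mirrors by `δ ↦ −δ`); the THREE-scale exclusion of `(1,1,1)` for the triple remains OPEN; the count
caps at 20 regardless.  No new definitions; nothing here bears on `DoorA26`, `MatrixDescartes` (stmt-ValiantsHypothesis-18050) or `VP ≠ VNP`.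

[this work] two-scale bookkeeping of the triple class.
-/
-- `Summit.ValiantsHypothesis.ValiantsHypothesis.…` repeats a component by the D-0017 layout
-- (single-conjunct summit), which the `dupNamespace` linter flags; the name is mandated.
set_option linter.dupNamespace false

namespace Summit.ValiantsHypothesis.ValiantsHypothesis.Theorems.LacunarySymmetroidMatrixDescartes.WallBubbling

open Finset Filter Topology
open Bubbling (polar polar_apply polar_comm polar_smul_left_right)
open scoped BigOperators

/-! ## 1. Scalar core -/

/-- Scalar core of the MIDDLE rule: upstream the `t`-slot is alive (`κμ ≤ |g₀₅|`, `|g₀₀| ≤ μ`); downstream the `(0,0)` and `(0,5)` entries are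
dominated by `μ'` and the `t²`-slot is alive (`κ'μ' ≤ E₀²e²|g₅₅|`); then `|Λ| ≥ 4/κ` forces `|Λ| ≤ (1 + 12/κ')·e`.  (No hypothesis on `g₅₅`
upstream: four regimes of `|Λ||g₅₅|` against `|g₀₅|`.) [this work] -/
theorem triple_mid_core {κ κ' μ μ' Λ e E₀ g₀₀ g₀₅ g₅₅ : ℝ} (hκ : 0 < κ) (hκ' : 0 < κ') (hμ : 0 < μ) (he : 0 < e) (hE₀ : 0 < E₀)
    (h05 : κ * μ ≤ |g₀₅|) (h00 : |g₀₀| ≤ μ)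
    (hdom00 : E₀ * E₀ * |g₀₀ + 2 * Λ * g₀₅ + Λ * Λ * g₅₅| ≤ μ')
    (hdom05 : E₀ * E₀ * e * |g₀₅ + Λ * g₅₅| ≤ μ')
    (halive : κ' * μ' ≤ E₀ * E₀ * (e * e) * |g₅₅|)
    (hΛ : 4 / κ ≤ |Λ|) : |Λ| ≤ (1 + 12 / κ') * e := by
  -- names: G = |g₀₅| > 0, H = |g₅₅| ≥ 0, l = |Λ|, P, Q, R the three downstream moduli
  set G := |g₀₅| with hGdef
  set H := |g₅₅| with hHdef
  set l := |Λ| with hldef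
  set P := |g₀₅ + Λ * g₅₅| with hPdef
  set Q := |g₀₀ + 2 * Λ * g₀₅ + Λ * Λ * g₅₅| with hQdef
  set R := |2 * g₀₅ + Λ * g₅₅| with hRdef
  have hG : 0 < G := lt_of_lt_of_le (mul_pos hκ hμ) h05
  have hH0 : 0 ≤ H := abs_nonneg _
  have hR0 : 0 ≤ R := abs_nonneg _
  have h4κ : 0 < 4 / κ := by positivity
  have hl : 0 < l := lt_of_lt_of_le h4κ hΛ
  have hμG : μ * κ ≤ G := by linarith
  have hGκ : |g₀₀| * κ ≤ G := le_trans (mul_le_mul_of_nonneg_right h00 hκ.le) hμG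
  -- the two downstream bounds with `E₀` divided out
  have B1 : κ' * P ≤ e * H := by
    have h1 := le_trans (mul_le_mul_of_nonneg_left hdom05 hκ'.le) halive
    have h' : (κ' * P) * (E₀ * E₀ * e) ≤ (e * H) * (E₀ * E₀ * e) := by
      calc (κ' * P) * (E₀ * E₀ * e) = κ' * (E₀ * E₀ * e * P) := by ring
        _ ≤ E₀ * E₀ * (e * e) * H := h1
        _ = (e * H) * (E₀ * E₀ * e) := by ring
    exact le_of_mul_le_mul_right h' (by positivity)
  have B2 : κ' * Q ≤ e * e * H := by
    have h1 := le_trans (mul_le_mul_of_nonneg_left hdom00 hκ'.le) halive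
    have h' : (κ' * Q) * (E₀ * E₀) ≤ (e * e * H) * (E₀ * E₀) := by
      calc (κ' * Q) * (E₀ * E₀) = κ' * (E₀ * E₀ * Q) := by ring
        _ ≤ E₀ * E₀ * (e * e) * H := h1
        _ = (e * e * H) * (E₀ * E₀) := by ring
    exact le_of_mul_le_mul_right h' (by positivity)
  -- triangle inequalities
  have hx : |Λ * g₅₅| = l * H := abs_mul Λ g₅₅
  have T1 : G - l * H ≤ P := by
    have := abs_sub_abs_le_abs_sub g₀₅ (-(Λ * g₅₅))
    rw [abs_neg, hx, sub_neg_eq_add] at this; exact this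
  have TR : l * H - 2 * G ≤ R := by
    have := abs_sub_abs_le_abs_sub (Λ * g₅₅) (-(2 * g₀₅))
    rw [abs_neg, hx, abs_mul, show |(2:ℝ)| = 2 by norm_num, show Λ * g₅₅ - -(2 * g₀₅) = 2 * g₀₅ + Λ * g₅₅ by ring] at this
    exact this
  have TQ : l * R - G / κ ≤ Q := by
    have t := abs_sub_abs_le_abs_sub (2 * Λ * g₀₅ + Λ * Λ * g₅₅) (-g₀₀)
    rw [abs_neg, show 2 * Λ * g₀₅ + Λ * Λ * g₅₅ - -g₀₀ = g₀₀ + 2 * Λ * g₀₅ + Λ * Λ * g₅₅ by ring,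
      show 2 * Λ * g₀₅ + Λ * Λ * g₅₅ = Λ * (2 * g₀₅ + Λ * g₅₅) by ring, abs_mul] at t
    have : |g₀₀| ≤ G / κ := by rw [le_div_iff₀ hκ]; exact hGκ
    linarith
  have TP : G - R ≤ P := by
    have := abs_sub_abs_le_abs_sub g₀₅ (-(g₀₅ + Λ * g₅₅))
    rw [abs_neg, show g₀₅ - -(g₀₅ + Λ * g₅₅) = 2 * g₀₅ + Λ * g₅₅ by ring] at this
    linarith
  -- closing moves
  have finish_sq : κ' * (l * l) ≤ 12 * (e * e) → l ≤ (1 + 12 / κ') * e := by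
    intro hsq
    by_contra hc
    push Not at hc
    have hc0 : 0 ≤ (1 + 12 / κ') * e := by positivity
    have h3 : ((1 + 12 / κ') * e) * ((1 + 12 / κ') * e) < l * l := mul_self_lt_mul_self hc0 hc
    have h4 : κ' * (((1 + 12 / κ') * e) * ((1 + 12 / κ') * e)) = (κ' + 24 + 144 / κ') * (e * e) := by
      field_simp
      ring
    have h5 : 0 < 144 / κ' := by positivity
    have h6 : κ' * (((1 + 12 / κ') * e) * ((1 + 12 / κ') * e)) < κ' * (l * l) := mul_lt_mul_of_pos_left h3 hκ'
    nlinarith [mul_pos he he]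
  have finish_lin : κ' * l ≤ 6 * e → l ≤ (1 + 12 / κ') * e := by
    intro h
    have h1 : l ≤ 6 * e / κ' := by rw [le_div_iff₀ hκ']; linarith
    have h2 : 6 * e / κ' ≤ (1 + 12 / κ') * e := by
      rw [div_le_iff₀ hκ', show (1 + 12 / κ') * e * κ' = (κ' + 12) * e by field_simp]
      nlinarith
    linarith
  -- case analysis on `l H` against `G`
  by_cases c1 : 3 * G ≤ l * H
  · -- Case 1
    have hH : 0 < H := by
      rcases hH0.lt_or_eq with h | h
      · exact h
      · rw [← h, mul_zero] at c1; linarith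
    have s1 : l * H / 3 ≤ R := by linarith
    have s2 : G / κ ≤ l * (l * H) / 12 := by
      -- G ≤ lH/3 and 1/κ ≤ l/4
      have a : G / κ ≤ (l * H / 3) / κ := div_le_div_of_nonneg_right (by linarith) hκ.le
      have b : (l * H / 3) / κ ≤ (l * H / 3) * (l / 4) := by
        rw [div_le_iff₀ hκ]
        have hk : 1 ≤ l / 4 * κ := by
          have := mul_le_mul_of_nonneg_right hΛ hκ.le
          rw [div_mul_cancel₀ _ hκ.ne'] at this
          linarith
        have hnn : 0 ≤ l * H / 3 := by positivity
        calc l * H / 3 = (l * H / 3) * 1 := by ring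
          _ ≤ (l * H / 3) * (l / 4 * κ) := mul_le_mul_of_nonneg_left hk hnn
          _ = (l * H / 3) * (l / 4) * κ := by ring
      have c : (l * H / 3) * (l / 4) = l * (l * H) / 12 := by ring
      linarith
    have s3 : l * (l * H) / 6 ≤ Q := by
      have h1 : l * (l * H) / 3 ≤ l * R := by
        calc l * (l * H) / 3 = l * (l * H / 3) := by ring
          _ ≤ l * R := mul_le_mul_of_nonneg_left s1 hl.le
      have hM : 0 ≤ l * (l * H) := by positivity
      linarith [TQ, s2, h1, hM]
    have s4 : κ' * (l * (l * H) / 6) ≤ e * e * H := le_trans (mul_le_mul_of_nonneg_left s3 hκ'.le) B2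
    apply finish_sq
    have hpos : 0 ≤ e * e * H := by positivity
    have : (κ' * (l * l)) * H ≤ (12 * (e * e)) * H := by
      calc (κ' * (l * l)) * H = 6 * (κ' * (l * (l * H) / 6)) := by ring
        _ ≤ 6 * (e * e * H) := by linarith
        _ ≤ (12 * (e * e)) * H := by linarith
    exact le_of_mul_le_mul_right this hH
  · push Not at c1
    by_cases c2 : l * H ≤ G / 2
    · -- Case 2a
      have s1 : κ' * (G / 2) ≤ e * H := le_trans (mul_le_mul_of_nonneg_left (by linarith [T1]) hκ'.le) B1
      apply finish_lin
      -- κ' l H ≤ κ' G/2 ≤ e H, and H > 0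
      have hH : 0 < H := by
        rcases hH0.lt_or_eq with h | h
        · exact h
        · rw [← h, mul_zero] at s1; nlinarith
      have hpos : 0 ≤ e * H := by positivity
      have : (κ' * l) * H ≤ (6 * e) * H := by
        calc (κ' * l) * H = κ' * (l * H) := by ring
          _ ≤ κ' * (G / 2) := mul_le_mul_of_nonneg_left c2 hκ'.le
          _ ≤ e * H := s1
          _ ≤ (6 * e) * H := by linarith
      exact le_of_mul_le_mul_right this hH
    · push Not at c2
      have hH : 0 < H := by
        rcases hH0.lt_or_eq with h | h
        · exact h
        · rw [← h, mul_zero] at c2; linarith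
      by_cases c3 : G / 2 ≤ R
      · -- 2b-i
        have s1 : l * G / 4 ≤ Q := by
          have a : G / κ ≤ l * G / 4 := by
            rw [div_le_iff₀ hκ]
            have hk : 1 ≤ l / 4 * κ := by
              have := mul_le_mul_of_nonneg_right hΛ hκ.le
              rw [div_mul_cancel₀ _ hκ.ne'] at this
              linarith
            calc G = G * 1 := by ring
              _ ≤ G * (l / 4 * κ) := mul_le_mul_of_nonneg_left hk hG.le
              _ = l * G / 4 * κ := by ring
          have b : l * (G / 2) ≤ l * R := mul_le_mul_of_nonneg_left c3 hl.le
          linarith [TQ]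
        have s2 : κ' * (l * G / 4) ≤ e * e * H := le_trans (mul_le_mul_of_nonneg_left s1 hκ'.le) B2
        apply finish_sq
        -- κ' l G/4 · l ≤ e² H l < e² 3G
        have s3 : e * e * (l * H) < e * e * (3 * G) := mul_lt_mul_of_pos_left c1 (mul_pos he he)
        have s4 : (κ' * (l * l)) * G ≤ (12 * (e * e)) * G := by
          calc (κ' * (l * l)) * G = 4 * (l * (κ' * (l * G / 4))) := by ring
            _ ≤ 4 * (l * (e * e * H)) := by
                have := mul_le_mul_of_nonneg_left s2 hl.le
                linarith
            _ = 4 * (e * e * (l * H)) := by ring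
            _ ≤ 4 * (e * e * (3 * G)) := by linarith
            _ = (12 * (e * e)) * G := by ring
        exact le_of_mul_le_mul_right s4 hG
      · -- 2b-ii
        push Not at c3
        have s1 : κ' * (G / 2) ≤ e * H := le_trans (mul_le_mul_of_nonneg_left (by linarith [TP]) hκ'.le) B1
        apply finish_lin
        have : (κ' * l) * H ≤ (6 * e) * H := by
          calc (κ' * l) * H = κ' * (l * H) := by ring
            _ ≤ κ' * (3 * G) := mul_le_mul_of_nonneg_left c1.le hκ'.le
            _ = 6 * (κ' * (G / 2)) := by ring
            _ ≤ 6 * (e * H) := by linarith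
            _ = (6 * e) * H := by ring
        exact le_of_mul_le_mul_right this hH
/-! ## 2. The middle rule -/

/-- **THE TRIPLE CLASS, MIDDLE RULE (two scales).**  Hypotheses verbatim those of `twoScale_monotone`.  If the confluent `t`-slot `(0,5)` of the
triple is alive in the first Gram-normalised limit, the `t²`-slot `(5,5)` is dead in the second (so the downstream degree is `≤ 1`); the mirrored
rule (second → first) is the same statement for the exponents `−δ` and the letters recentred at the second cluster. [this work] -/
theorem twoScale_triple_mid (δs : ℕ → Fin 6 → ℝ) (δ0 : Fin 6 → ℝ)
    (hδ : ∀ l, Tendsto (fun ν => δs ν l) atTop (𝓝 (δ0 l))) (h05 : δ0 5 = δ0 0)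
    (U : ℕ → Fin 6 → Matrix (Fin 2) (Fin 2) ℝ) (L : ℕ → ℝ) (hL : Tendsto L atTop atTop)
    (μ μ' : ℕ → ℝ) (hμ : ∀ ν, 0 < μ ν) (hμ' : ∀ ν, 0 < μ' ν)
    (hdom : ∀ ν a b, |polar (if a = 0 then U ν 0 + U ν 5 else if a = 5 then (δs ν 5 - δs ν 0) • U ν 5 else U ν a)
      (if b = 0 then U ν 0 + U ν 5 else if b = 5 then (δs ν 5 - δs ν 0) • U ν 5 else U ν b)| ≤ μ ν)
    (hdom' : ∀ ν a b, |polar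
      (if a = 0 then Real.exp (δs ν 0 * L ν) • U ν 0 + Real.exp (δs ν 5 * L ν) • U ν 5
        else if a = 5 then (δs ν 5 - δs ν 0) • (Real.exp (δs ν 5 * L ν) • U ν 5) else Real.exp (δs ν a * L ν) • U ν a)
      (if b = 0 then Real.exp (δs ν 0 * L ν) • U ν 0 + Real.exp (δs ν 5 * L ν) • U ν 5
        else if b = 5 then (δs ν 5 - δs ν 0) • (Real.exp (δs ν 5 * L ν) • U ν 5) else Real.exp (δs ν b * L ν) • U ν b)| ≤ μ' ν)
    (Γ Γ' : Fin 6 → Fin 6 → ℝ)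
    (hΓ : ∀ a b, Tendsto (fun ν => polar (if a = 0 then U ν 0 + U ν 5 else if a = 5 then (δs ν 5 - δs ν 0) • U ν 5 else U ν a)
      (if b = 0 then U ν 0 + U ν 5 else if b = 5 then (δs ν 5 - δs ν 0) • U ν 5 else U ν b) / μ ν) atTop (𝓝 (Γ a b)))
    (hΓ' : ∀ a b, Tendsto (fun ν => polar
      (if a = 0 then Real.exp (δs ν 0 * L ν) • U ν 0 + Real.exp (δs ν 5 * L ν) • U ν 5
        else if a = 5 then (δs ν 5 - δs ν 0) • (Real.exp (δs ν 5 * L ν) • U ν 5) else Real.exp (δs ν a * L ν) • U ν a)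
      (if b = 0 then Real.exp (δs ν 0 * L ν) • U ν 0 + Real.exp (δs ν 5 * L ν) • U ν 5
        else if b = 5 then (δs ν 5 - δs ν 0) • (Real.exp (δs ν 5 * L ν) • U ν 5) else Real.exp (δs ν b * L ν) • U ν b) / μ' ν)
      atTop (𝓝 (Γ' a b)))
    (h1 : Γ 0 5 ≠ 0) : Γ' 5 5 = 0 := by
  by_contra h2
  set κ : ℝ := |Γ 0 5| / 2 with hκ
  set κ' : ℝ := |Γ' 5 5| / 2 with hκ'
  have hκpos : 0 < κ := by rw [hκ]; exact half_pos (abs_pos.mpr h1)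
  have hκ'pos : 0 < κ' := by rw [hκ']; exact half_pos (abs_pos.mpr h2)
  have h50 : ((5 : Fin 6) = 0) = False := by simp
  have h05' : ((0 : Fin 6) = 5) = False := by simp
  have hw0 : Tendsto (fun ν => δs ν 5 - δs ν 0) atTop (𝓝 0) := by
    have := (hδ 5).sub (hδ 0)
    rw [h05, sub_self] at this
    exact this
  have e1 : ∀ᶠ ν in atTop, κ * μ ν ≤ |polar (U ν 0 + U ν 5) ((δs ν 5 - δs ν 0) • U ν 5)| := by
    have h := ((hΓ 0 5).abs).eventually_const_lt (show κ < |Γ 0 5| by rw [hκ]; linarith [abs_pos.mpr h1])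
    filter_upwards [h] with ν hν
    simp only [h50, h05', if_false, if_true] at hν
    rw [abs_div, abs_of_pos (hμ ν), lt_div_iff₀ (hμ ν)] at hν
    exact hν.le
  have e2 : ∀ᶠ ν in atTop, κ' * μ' ν
      ≤ |polar ((δs ν 5 - δs ν 0) • (Real.exp (δs ν 5 * L ν) • U ν 5)) ((δs ν 5 - δs ν 0) • (Real.exp (δs ν 5 * L ν) • U ν 5))| := by
    have h := ((hΓ' 5 5).abs).eventually_const_lt (show κ' < |Γ' 5 5| by rw [hκ']; linarith [abs_pos.mpr h2])
    filter_upwards [h] with ν hν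
    simp only [h50, if_false, if_true] at hν
    rw [abs_div, abs_of_pos (hμ' ν), lt_div_iff₀ (hμ' ν)] at hν
    exact hν.le
  have eb : ∀ᶠ ν in atTop, 0 * Real.exp ((δs ν 5 - δs ν 0) * L ν) + 4 / κ
      < |dslope (fun y : ℝ => Real.exp (y * L ν)) 0 (δs ν 5 - δs ν 0)| :=
    eventually_dslope_exp_gt (fun ν => δs ν 5 - δs ν 0) L hw0 hL 0 (4 / κ) le_rfl (by positivity)
  have ea : ∀ᶠ ν in atTop, (1 + 12 / κ') * Real.exp ((δs ν 5 - δs ν 0) * L ν) + 0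
      < |dslope (fun y : ℝ => Real.exp (y * L ν)) 0 (δs ν 5 - δs ν 0)| :=
    eventually_dslope_exp_gt (fun ν => δs ν 5 - δs ν 0) L hw0 hL (1 + 12 / κ') 0 (by positivity) le_rfl
  have hfalse : ∀ᶠ ν : ℕ in atTop, False := by
    filter_upwards [e1, e2, eb, ea] with ν hν1 hν2 hνb hνa
    obtain ⟨i55, i05, i00⟩ := triple_frameShift (δs ν) (U ν) (L ν)
    set g55 := polar ((δs ν 5 - δs ν 0) • U ν 5) ((δs ν 5 - δs ν 0) • U ν 5) with hg55
    set g05 := polar (U ν 0 + U ν 5) ((δs ν 5 - δs ν 0) • U ν 5) with hg05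
    set g00 := polar (U ν 0 + U ν 5) (U ν 0 + U ν 5) with hg00
    set Λ := dslope (fun y : ℝ => Real.exp (y * L ν)) 0 (δs ν 5 - δs ν 0) with hΛ
    set E₀ := Real.exp (δs ν 0 * L ν) with hE₀
    set e := Real.exp ((δs ν 5 - δs ν 0) * L ν) with he
    have hE₀pos : 0 < E₀ := Real.exp_pos _
    have hepos : 0 < e := Real.exp_pos _
    have h00le : |g00| ≤ μ ν := by have := hdom ν 0 0; simp only [h05', if_false, if_true] at this; exact this
    have hdom00 : E₀ * E₀ * |g00 + 2 * Λ * g05 + Λ * Λ * g55| ≤ μ' ν := by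
      have := hdom' ν 0 0
      simp only [h05', if_false, if_true] at this
      rw [i00, abs_mul, abs_of_pos (mul_pos hE₀pos hE₀pos)] at this
      exact this
    have hdom05 : E₀ * E₀ * e * |g05 + Λ * g55| ≤ μ' ν := by
      have := hdom' ν 0 5
      simp only [h50, h05', if_false, if_true] at this
      rw [i05, abs_mul, abs_of_pos (by positivity)] at this
      exact this
    have halive : κ' * μ' ν ≤ E₀ * E₀ * (e * e) * |g55| := by
      rw [i55, abs_mul, abs_of_pos (by positivity)] at hν2
      exact hν2
    have hΛge : 4 / κ ≤ |Λ| := by rw [zero_mul, zero_add] at hνb; exact hνb.le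
    have hcore := triple_mid_core hκpos hκ'pos (hμ ν) hepos hE₀pos hν1 h00le hdom00 hdom05 halive hΛge
    rw [add_zero] at hνa
    exact absurd (lt_of_le_of_lt hcore hνa) (lt_irrefl _)
  exact hfalse.exists.elim fun _ h => h

end Summit.ValiantsHypothesis.ValiantsHypothesis.Theorems.LacunarySymmetroidMatrixDescartes.WallBubbling
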